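import Mathlib
import HarnessLib
import Summits.HubbardSuperconductivity.HubbardSuperconductivity.Theorems.KLProgrammeMatsubaraSliceBubbleCross
import Summits.HubbardSuperconductivity.HubbardSuperconductivity.Theorems.KLProgrammeKLRegimeSplitLegCount

/-!
# Route `KLProgramme` — ENGINE (stmt-HubbardSuperconductivity-20437 `KLRegimeEngineV17F2`), row (c) binder #8 (`hexLadMV` ★ v19), E1-LEDGER line #8 LANE item
# «(F2)¹ one loop, FORWARD branch»: the transfer perturbation of the particle–hole bubble ABOVE SCALE `Λ_{n'}` as a (T)-LADDER over slice pairs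
# (cell gate-hubbard-kl, seat hubbard-kl-k3c2-p2 g33, technique «thermal-bar induction n ≤ nScales β + 1 with EngineBoundsAtV4S sums»)

WHY.  The window-profile moduli `ε` of binder #8's value rows (`klph_phValue_row_profile_ref_le`, …) are, at one loop, the variation of the
crossed-channel bubbles `χ^{>Λ_{n'}}` when the transfer moves by `O(Λ_{n'})` (E1-LEDGER rev 14 §17, item (F2)).  In the forward branch
(`v_F·|transfer| ≲ Λ_{n'}`) the covariance above scale `Λ_{n'}` is the ladder `Σ_{m ≤ n'} C_m` of slices, so the bubble is the double sum over
slice PAIRS `(m, m')`, `m, m' ≤ n'`, of the pair bubbles `β⁻¹Σ_i ∫ W(e)·Φ_m(ω_i,e)·Ψ_{m'}(ω_i + q₀, e + δ(e)) de` (radial model of the lineage: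
`Φ_m(k₀,e) = (f_m(s)/s)(ik₀+e)`, `s = k₀² + e²`, shell weight `f_m` supported in `(Λ_m/2)² < s < (4Λ_m)²`, `‖f_m‖ ≤ M_f`, `L`-Lipschitz with
`L ≤ ℓ/Λ_m²` — SCALE-FREE data).  This module proves the transfer-Lipschitz law of that ladder with constant `∝ 1/Λ_{n'}`:
* §1 two more PAIR lemmas beside the same-slice one (✓ `klsp_slice_bubble_shift_norm_le`, `C/Λ_n`) and the cross-DOWN one (second line one
  scale COARSER, ✓ `klsp_slice_bubble_shift_norm_le_cross`): the cross-UP pair (second line one scale FINER, `klsp_slice_bubble_shift_norm_le_up`,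
  constant `(1024/π)·M_f·(768ℓ' + 3088M_f')`) and the cross-down pair re-keyed to the coarser line's own scale data (`…_down`);
* §2 the SUPPORT GAP: for `|q₀| + δ_max ≤ Λ_m/4` the pair integrand of `(m, m')` vanishes identically unless `|m − m'| ≤ 1`
  (`kllb_pair_integrand_eq_zero_of_inner/_of_outer`, reverse triangle inequality in the `(k₀,e)` plane);
* §3 the (T)-LADDER ARITHMETIC `Σ_{m ≤ n'} Λ_m⁻¹ ≤ (4/3)·Λ_{n'}⁻¹` (`kllb_sum_inv_klScale_le`, from `sum_inv_four_pow_reflect_le`);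
* §4 (in the sequel `…MatsubaraLadderBubbleTransferLaw`) the LADDER LAW: for `n' ≤ n_β + 1` and `|q₀| + δ_max ≤ Λ_{n'}/4`,
  `Σ_{m ≤ n'} Σ_{m' ≤ n'} ‖β⁻¹Σ_i ∫ W·Φ_m·(Ψ_{m'}(shifted) − Ψ_{m'}) de‖ ≤ (4/3)·(1024/π)·M_f·(1584ℓ' + 6354M_f')·B_W·(|q₀| + δ_max)/Λ_{n'}`
  (`kllb_ladder_bubble_shift_norm_le`) — the `N0/Λ_{n'}` forward-branch constant of (F2)¹ with explicit crude numbers, every `M`, every `β ≥ klBetaMin`.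
Pure analysis over landed lemmas; no definitions; nothing about the model, (c), K3 or superconductivity is asserted.
References: E1-LEDGER-AT-KILL rev 14 §17 (F2); Salmhofer, *Renormalization* (1999) Prop. 4.13 (4.225); BGM 2006 §2.5; DECOMP App. E Lemma E.2 (iv)(a).
-/

noncomputable section

namespace Summit.HubbardSuperconductivity.HubbardSuperconductivity.Theorems.KLRegimeSplit

set_option linter.dupNamespace false -- summit = problem name (single-conjunct summit), D-0017

open Real Finset MeasureTheory Complex Literature.MathematicalPhysics.QuantumLattice Literature.Probability.LatticeModels
open Summit.HubbardSuperconductivity.HubbardSuperconductivity.Theorems.KLProgrammeLegKernels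

/-! ## §0 Scale arithmetic -/

section Scales

/-- `Λ_{n+2} = Λ_n/16`. -/
theorem kllb_klScale_succ_succ (n : ℕ) : klScale klE0 (n + 2) = klScale klE0 n / 16 := by
  rw [show n + 2 = (n + 1) + 1 from rfl, klth_klScale_succ, klth_klScale_succ]; ring

/-- `Λ_m⁻¹ = 4^{-(n'−m)}·Λ_{n'}⁻¹` for `m ≤ n'`. -/
theorem kllb_inv_klScale_eq {m n' : ℕ} (h : m ≤ n') :
    (klScale klE0 m)⁻¹ = ((4 : ℝ) ^ (n' - m))⁻¹ * (klScale klE0 n')⁻¹ := by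
  have hm := klth_klScale_pos m
  have hn := klth_klScale_pos n'
  have hq := klth_klScale_div_klScale h
  rw [← hq]; field_simp

end Scales

/-! ## §1 Two more slice-pair lemmas: second line one scale FINER / one scale COARSER (own-scale data) -/

section Pairs

variable {f f' : ℝ → ℂ} {Mf Lf' Mf' ℓ' : ℝ} {W : ℝ → ℂ} {δ : ℝ → ℝ} {BW δmax : ℝ}

/-- **The transfer perturbation for the cross-scale pair `(n, n+1)` (second line one scale FINER), in scale form.**  As
`klsp_slice_bubble_shift_norm_le`, but the second line's weight `f'` carries the STANDARD scale-`(n+1)` data: `‖f'‖ ≤ M_f'`, `L_f'`-Lipschitz with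
`L_f' ≤ ℓ'/Λ_{n+1}²`, `f'(s) = 0` for `s ≤ (Λ_{n+1}/2)²` and for `s ≥ (4Λ_{n+1})²`; the first line is a standard scale-`n` weight; `‖W‖ ≤ B_W` on
`|e| < 4Λ_n`.  Then at `n ≤ n_β + 1`:
`‖β⁻¹ • Σ_i ∫ W(e)·Φ(ω_i,e)·(Ψ(ω_i+q₀, e+δ(e)) − Ψ(ω_i,e)) de‖ ≤ (1024/π)·M_f·(768ℓ' + 3088M_f')·B_W·(|q₀| + δ_max)/Λ_n`. -/
theorem klsp_slice_bubble_shift_norm_le_up (hbd : ∀ s, ‖f s‖ ≤ Mf) {n : ℕ}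
    (hin : ∀ s, s ≤ (klScale klE0 n / 2) ^ 2 → f s = 0) (hout : ∀ s, (4 * klScale klE0 n) ^ 2 ≤ s → f s = 0)
    (hlip' : ∀ s s', ‖f' s - f' s'‖ ≤ Lf' * |s - s'|) (hbd' : ∀ s, ‖f' s‖ ≤ Mf') (hLf' : Lf' ≤ ℓ' / klScale klE0 (n + 1) ^ 2)
    (hin' : ∀ s, s ≤ (klScale klE0 (n + 1) / 2) ^ 2 → f' s = 0) (hout' : ∀ s, (4 * klScale klE0 (n + 1)) ^ 2 ≤ s → f' s = 0)
    (hBW : 0 ≤ BW) (hWbd : ∀ e, |e| < 4 * klScale klE0 n → ‖W e‖ ≤ BW) (hδ0 : 0 ≤ δmax) (hδ : ∀ e, |δ e| ≤ δmax)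
    (q₀ : ℝ) {β : ℝ} (hβ : klBetaMin ≤ β) (hn : n ≤ nScales β + 1) (M : ℕ) :
    ‖β⁻¹ • ∑ i : MatsubaraIdx M, ∫ e,
        W e * (f (matsubaraFreq β M i ^ 2 + e ^ 2) / (((matsubaraFreq β M i ^ 2 + e ^ 2 : ℝ)) : ℂ) * (I * (matsubaraFreq β M i) + e)) *
          (f' ((matsubaraFreq β M i + q₀) ^ 2 + (e + δ e) ^ 2) / ((((matsubaraFreq β M i + q₀) ^ 2 + (e + δ e) ^ 2 : ℝ)) : ℂ) *
              (I * ((matsubaraFreq β M i + q₀ : ℝ) : ℂ) + ((e + δ e : ℝ) : ℂ)) -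
            f' (matsubaraFreq β M i ^ 2 + e ^ 2) / (((matsubaraFreq β M i ^ 2 + e ^ 2 : ℝ)) : ℂ) * (I * (matsubaraFreq β M i) + e))‖ ≤
      1024 / Real.pi * Mf * (768 * ℓ' + 3088 * Mf') * BW * (|q₀| + δmax) / klScale klE0 n := by
  set Λ := klScale klE0 n with hΛdef
  have hΛ1 : klScale klE0 (n + 1) = Λ / 4 := by rw [hΛdef]; exact klth_klScale_succ n
  have hΛ : 0 < Λ := klth_klScale_pos n
  have hβ0 : 0 < β := pos_of_klBetaMin_le hβ
  have hMf : 0 ≤ Mf := (norm_nonneg _).trans (hbd 0)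
  have hMf' : 0 ≤ Mf' := (norm_nonneg _).trans (hbd' 0)
  have hr₁ : 0 < Λ / 2 := by positivity
  have hr₁' : 0 < Λ / 4 / 2 := by positivity
  have hr : 0 < 4 * Λ := by positivity
  have hr' : 0 < 4 * (Λ / 4) := by positivity
  have hLf'0 : 0 ≤ Lf' := by
    have := hlip' 0 1; have h0 : (0:ℝ) ≤ ‖f' 0 - f' 1‖ := norm_nonneg _; norm_num at this; linarith
  rw [hΛ1] at hLf' hin' hout'
  have hℓ' : 0 ≤ ℓ' := by
    have : 0 ≤ ℓ' / (Λ / 4) ^ 2 := hLf'0.trans hLf'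
    rwa [le_div_iff₀ (by positivity), zero_mul] at this
  -- the second propagator in singularity-free form: `g' = f'/s`
  have hg'supp : ∀ s, (4 * (Λ / 4)) ^ 2 ≤ s → (fun s : ℝ => f' s / ((s : ℝ) : ℂ)) s = 0 := fun s hs => by
    simp only [hout' s hs, zero_div]
  have hg'lip : ∀ s s', ‖(fun s : ℝ => f' s / ((s : ℝ) : ℂ)) s - (fun s : ℝ => f' s / ((s : ℝ) : ℂ)) s'‖ ≤
      (Lf' / (Λ / 4 / 2) ^ 2 + Mf' / (Λ / 4 / 2) ^ 4) * |s - s'| := fun s s' =>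
    klsp_div_lipschitz hlip' hbd' hin' hr₁' s s'
  have hg'bd : ∀ s, ‖(fun s : ℝ => f' s / ((s : ℝ) : ℂ)) s‖ ≤ Mf' / (Λ / 4 / 2) ^ 2 := fun s => klsp_div_norm_le hbd' hin' hr₁' s
  have hgsupp : ∀ s, (4 * Λ) ^ 2 ≤ s → (fun s : ℝ => f s / ((s : ℝ) : ℂ)) s = 0 := fun s hs => by
    simp only [hout s hs, zero_div]
  -- constants
  set A : ℝ := Mf / (Λ / 2) with hA
  set K : ℝ := 3 * (Lf' / (Λ / 4 / 2) ^ 2 + Mf' / (Λ / 4 / 2) ^ 4) * (4 * (Λ / 4)) ^ 2 + Mf' / (Λ / 4 / 2) ^ 2 with hK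
  have hA0 : 0 ≤ A := by positivity
  have hK0 : 0 ≤ K := by positivity
  set D : ℝ := |q₀| + δmax with hD
  have hD0 : 0 ≤ D := by positivity
  -- the generic perturbation lemma with `Φ = Φ_{f/s}`, `Ψ = Φ_{f'/s}`
  have main := klsp_discrete_perturb_norm_le
    (Φ := fun k₀ e => f (k₀ ^ 2 + e ^ 2) / (((k₀ ^ 2 + e ^ 2 : ℝ)) : ℂ) * (I * k₀ + e))
    (Ψ := fun k₀ e => f' (k₀ ^ 2 + e ^ 2) / (((k₀ ^ 2 + e ^ 2 : ℝ)) : ℂ) * (I * k₀ + e)) (W := W) (δ := δ)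
    hA0 hK0 hBW hr.le hδ0
    (fun k₀ e => klsp_div_propagator_norm_le hbd hin hr₁ k₀ e)
    (fun k₀ hk e => klsp_zero_of_le_abs_fst hgsupp hr.le hk e)
    (fun k₀ e he => klsp_zero_of_le_abs_snd hgsupp hr.le k₀ he)
    (fun k₀ e k₀' e' => klsp_lipschitz hg'lip hg'bd hg'supp hr' k₀ e k₀' e')
    hWbd hδ q₀ hβ0 M
  refine main.trans ?_
  -- arithmetic
  have hcount := klsp_count_factor_le hβ hn
  rw [← hΛdef] at hcount
  have hKle : K ≤ (3072 * ℓ' + 12352 * Mf') / Λ ^ 2 := by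
    have hKeq : K = 192 * Lf' + 12352 * Mf' / Λ ^ 2 := by
      rw [hK]; field_simp; ring
    rw [hKeq, add_div]
    have h16 : Lf' ≤ 16 * ℓ' / Λ ^ 2 := by
      refine hLf'.trans (le_of_eq ?_); field_simp; ring
    have : 192 * Lf' ≤ 3072 * ℓ' / Λ ^ 2 := by
      have := mul_le_mul_of_nonneg_left h16 (show (0:ℝ) ≤ 192 by norm_num)
      refine this.trans (le_of_eq ?_); ring
    linarith
  have hinner : 2 * (4 * Λ) * (BW * A * (K * D)) ≤ 2 * (4 * Λ) * (BW * A * ((3072 * ℓ' + 12352 * Mf') / Λ ^ 2 * D)) := by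
    have := mul_le_mul_of_nonneg_right hKle hD0
    have := mul_le_mul_of_nonneg_left this (show 0 ≤ BW * A by positivity)
    exact mul_le_mul_of_nonneg_left this (by positivity)
  calc (4 * Λ / Real.pi + 3 / β) * (2 * (4 * Λ) * (BW * A * (K * D)))
      ≤ (16 / Real.pi * Λ) * (2 * (4 * Λ) * (BW * A * ((3072 * ℓ' + 12352 * Mf') / Λ ^ 2 * D))) :=
        mul_le_mul hcount hinner (by positivity) (by positivity)
    _ = 1024 / Real.pi * Mf * (768 * ℓ' + 3088 * Mf') * BW * D / Λ := by
        rw [hA]; field_simp; ring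

/-- **The transfer perturbation for the cross-scale pair `(n+1, n)` (second line one scale COARSER), with the second line's OWN scale-`n`
data.**  First line: standard scale-`(n+1)` weight; second line: `‖f'‖ ≤ M_f'`, `L_f' ≤ ℓ'/Λ_n²`, `f'(s) = 0` for `s ≤ (Λ_n/2)²` and for
`s ≥ (4Λ_n)²`; `‖W‖ ≤ B_W` on `|e| < 4Λ_{n+1}`; `n + 1 ≤ n_β + 1`.  Then (re-keying of `klsp_slice_bubble_shift_norm_le_cross`, whose hypotheses
at scale `n+1` — `f' = 0` below `(Λ_{n+1}/2)²` and above `(16Λ_{n+1})² = (4Λ_n)²`, `L_f' ≤ ℓ'/Λ_{n+1}²` — are WEAKER):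
`‖…‖ ≤ (1024/π)·M_f·(768ℓ' + 3073M_f')·B_W·(|q₀| + δ_max)/Λ_{n+1}`. -/
theorem klsp_slice_bubble_shift_norm_le_down (hbd : ∀ s, ‖f s‖ ≤ Mf) {n : ℕ}
    (hin : ∀ s, s ≤ (klScale klE0 (n + 1) / 2) ^ 2 → f s = 0) (hout : ∀ s, (4 * klScale klE0 (n + 1)) ^ 2 ≤ s → f s = 0)
    (hlip' : ∀ s s', ‖f' s - f' s'‖ ≤ Lf' * |s - s'|) (hbd' : ∀ s, ‖f' s‖ ≤ Mf') (hLf' : Lf' ≤ ℓ' / klScale klE0 n ^ 2)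
    (hin' : ∀ s, s ≤ (klScale klE0 n / 2) ^ 2 → f' s = 0) (hout' : ∀ s, (4 * klScale klE0 n) ^ 2 ≤ s → f' s = 0)
    (hBW : 0 ≤ BW) (hWbd : ∀ e, |e| < 4 * klScale klE0 (n + 1) → ‖W e‖ ≤ BW) (hδ0 : 0 ≤ δmax) (hδ : ∀ e, |δ e| ≤ δmax)
    (q₀ : ℝ) {β : ℝ} (hβ : klBetaMin ≤ β) (hn : n + 1 ≤ nScales β + 1) (M : ℕ) :
    ‖β⁻¹ • ∑ i : MatsubaraIdx M, ∫ e,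
        W e * (f (matsubaraFreq β M i ^ 2 + e ^ 2) / (((matsubaraFreq β M i ^ 2 + e ^ 2 : ℝ)) : ℂ) * (I * (matsubaraFreq β M i) + e)) *
          (f' ((matsubaraFreq β M i + q₀) ^ 2 + (e + δ e) ^ 2) / ((((matsubaraFreq β M i + q₀) ^ 2 + (e + δ e) ^ 2 : ℝ)) : ℂ) *
              (I * ((matsubaraFreq β M i + q₀ : ℝ) : ℂ) + ((e + δ e : ℝ) : ℂ)) -
            f' (matsubaraFreq β M i ^ 2 + e ^ 2) / (((matsubaraFreq β M i ^ 2 + e ^ 2 : ℝ)) : ℂ) * (I * (matsubaraFreq β M i) + e))‖ ≤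
      1024 / Real.pi * Mf * (768 * ℓ' + 3073 * Mf') * BW * (|q₀| + δmax) / klScale klE0 (n + 1) := by
  have hΛ := klth_klScale_pos n
  have hΛ1 : klScale klE0 (n + 1) = klScale klE0 n / 4 := klth_klScale_succ n
  have hLf'0 : 0 ≤ Lf' := by
    have := hlip' 0 1; have h0 : (0:ℝ) ≤ ‖f' 0 - f' 1‖ := norm_nonneg _; norm_num at this; linarith
  have hℓ' : 0 ≤ ℓ' := by
    have : 0 ≤ ℓ' / klScale klE0 n ^ 2 := hLf'0.trans hLf'
    rwa [le_div_iff₀ (by positivity), zero_mul] at this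
  -- re-key the second line's hypotheses to scale `n + 1`
  have hLf'' : Lf' ≤ ℓ' / klScale klE0 (n + 1) ^ 2 := by
    refine hLf'.trans ?_
    rw [hΛ1]
    exact div_le_div_of_nonneg_left hℓ' (by positivity) (by nlinarith)
  have hin'' : ∀ s, s ≤ (klScale klE0 (n + 1) / 2) ^ 2 → f' s = 0 := fun s hs => hin' s (hs.trans (by rw [hΛ1]; nlinarith))
  have hout'' : ∀ s, (16 * klScale klE0 (n + 1)) ^ 2 ≤ s → f' s = 0 := fun s hs => hout' s (by rw [hΛ1] at hs; nlinarith)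
  exact klsp_slice_bubble_shift_norm_le_cross hbd hin hout hlip' hbd' hLf'' hin'' hout'' hBW hWbd hδ0 hδ q₀ hβ hn M

end Pairs

/-! ## §2 The support gap: non-adjacent pairs vanish identically for small transfers -/

section Gap

/-- The shifted point is at radius at most `radius + (|q₀| + |d|)` (Minkowski in the `(k₀, e)` plane, then `√(q₀² + d²) ≤ |q₀| + |d|`). -/
theorem kllb_sqrt_shift_le (k₀ e q₀ d : ℝ) :
    Real.sqrt ((k₀ + q₀) ^ 2 + (e + d) ^ 2) ≤ Real.sqrt (k₀ ^ 2 + e ^ 2) + (|q₀| + |d|) := by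
  have hS : 0 ≤ k₀ ^ 2 + e ^ 2 := by positivity
  have hT : 0 ≤ q₀ ^ 2 + d ^ 2 := by positivity
  -- Cauchy–Schwarz in the plane
  have hcs : k₀ * q₀ + e * d ≤ Real.sqrt (k₀ ^ 2 + e ^ 2) * Real.sqrt (q₀ ^ 2 + d ^ 2) := by
    have key : (k₀ * q₀ + e * d) ^ 2 ≤ (k₀ ^ 2 + e ^ 2) * (q₀ ^ 2 + d ^ 2) := by nlinarith [sq_nonneg (k₀ * d - q₀ * e)]
    calc k₀ * q₀ + e * d ≤ |k₀ * q₀ + e * d| := le_abs_self _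
      _ = Real.sqrt ((k₀ * q₀ + e * d) ^ 2) := (Real.sqrt_sq_eq_abs _).symm
      _ ≤ Real.sqrt ((k₀ ^ 2 + e ^ 2) * (q₀ ^ 2 + d ^ 2)) := Real.sqrt_le_sqrt key
      _ = Real.sqrt (k₀ ^ 2 + e ^ 2) * Real.sqrt (q₀ ^ 2 + d ^ 2) := Real.sqrt_mul hS _
  -- Minkowski
  have hmink : Real.sqrt ((k₀ + q₀) ^ 2 + (e + d) ^ 2) ≤ Real.sqrt (k₀ ^ 2 + e ^ 2) + Real.sqrt (q₀ ^ 2 + d ^ 2) := by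
    rw [Real.sqrt_le_left (by positivity)]
    nlinarith [Real.sq_sqrt hS, Real.sq_sqrt hT, hcs, Real.sqrt_nonneg (k₀ ^ 2 + e ^ 2), Real.sqrt_nonneg (q₀ ^ 2 + d ^ 2)]
  -- the transfer's Euclidean length is at most its `ℓ¹` length
  have hl1 : Real.sqrt (q₀ ^ 2 + d ^ 2) ≤ |q₀| + |d| := by
    rw [Real.sqrt_le_left (by positivity)]
    nlinarith [sq_abs q₀, sq_abs d, abs_nonneg q₀, abs_nonneg d]
  linarith

/-- The shifted point is at radius at least `radius − (|q₀| + |d|)`. -/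
theorem kllb_sqrt_shift_ge (k₀ e q₀ d : ℝ) :
    Real.sqrt (k₀ ^ 2 + e ^ 2) - (|q₀| + |d|) ≤ Real.sqrt ((k₀ + q₀) ^ 2 + (e + d) ^ 2) := by
  have h := kllb_sqrt_shift_le (k₀ + q₀) (e + d) (-q₀) (-d)
  simp only [add_neg_cancel_right, abs_neg] at h
  linarith

variable {f f' : ℝ → ℂ} {R₁ R₂ D : ℝ} {δ : ℝ → ℝ}

/-- **Support gap, second line far INSIDE.**  If `f(s) = 0` for `s ≤ R₁²`, `f'(s) = 0` for `s ≥ R₂²` (`R₂ ≥ 0`) and `R₂ + |q₀| + |δ(e)| ≤ R₁`, then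
the pair integrand `Φ_f(k₀,e)·(Ψ_{f'}(k₀+q₀, e+δ(e)) − Ψ_{f'}(k₀,e))` vanishes (for any prefactor). -/
theorem kllb_pair_integrand_eq_zero_of_inner (hin : ∀ s, s ≤ R₁ ^ 2 → f s = 0) (hout' : ∀ s, R₂ ^ 2 ≤ s → f' s = 0) (hR₂ : 0 ≤ R₂)
    {q₀ k₀ e : ℝ} (hgap : R₂ + (|q₀| + |δ e|) ≤ R₁) (W : ℂ) :
    W * (f (k₀ ^ 2 + e ^ 2) / (((k₀ ^ 2 + e ^ 2 : ℝ)) : ℂ) * (I * k₀ + e)) *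
        (f' ((k₀ + q₀) ^ 2 + (e + δ e) ^ 2) / ((((k₀ + q₀) ^ 2 + (e + δ e) ^ 2 : ℝ)) : ℂ) *
            (I * ((k₀ + q₀ : ℝ) : ℂ) + ((e + δ e : ℝ) : ℂ)) -
          f' (k₀ ^ 2 + e ^ 2) / (((k₀ ^ 2 + e ^ 2 : ℝ)) : ℂ) * (I * k₀ + e)) = 0 := by
  rcases le_or_gt (k₀ ^ 2 + e ^ 2) (R₁ ^ 2) with hs | hs
  · rw [hin _ hs]; simp
  · have hR₁ : 0 ≤ R₁ := hR₂.trans ((le_add_of_nonneg_right (by positivity)).trans hgap)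
    have hrad : R₁ < Real.sqrt (k₀ ^ 2 + e ^ 2) := by
      rw [show R₁ = Real.sqrt (R₁ ^ 2) by rw [Real.sqrt_sq hR₁]]
      exact Real.sqrt_lt_sqrt (by positivity) hs
    have h1 : R₂ ^ 2 ≤ k₀ ^ 2 + e ^ 2 := by nlinarith [abs_nonneg q₀, abs_nonneg (δ e)]
    have h2 : R₂ ^ 2 ≤ (k₀ + q₀) ^ 2 + (e + δ e) ^ 2 := by
      have hge := kllb_sqrt_shift_ge k₀ e q₀ (δ e)
      have hR₂le : R₂ ≤ Real.sqrt ((k₀ + q₀) ^ 2 + (e + δ e) ^ 2) := by linarith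
      calc R₂ ^ 2 ≤ Real.sqrt ((k₀ + q₀) ^ 2 + (e + δ e) ^ 2) ^ 2 := by gcongr
        _ = (k₀ + q₀) ^ 2 + (e + δ e) ^ 2 := Real.sq_sqrt (by positivity)
    rw [hout' _ h1, hout' _ h2]; simp

/-- **Support gap, second line far OUTSIDE.**  If `f(s) = 0` for `s ≥ R₁²` (`R₁ ≥ 0`), `f'(s) = 0` for `s ≤ R₂²` and `R₁ + |q₀| + |δ(e)| ≤ R₂`,
then the pair integrand vanishes. -/
theorem kllb_pair_integrand_eq_zero_of_outer (hout : ∀ s, R₁ ^ 2 ≤ s → f s = 0) (hR₁ : 0 ≤ R₁) (hin' : ∀ s, s ≤ R₂ ^ 2 → f' s = 0)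
    {q₀ k₀ e : ℝ} (hgap : R₁ + (|q₀| + |δ e|) ≤ R₂) (W : ℂ) :
    W * (f (k₀ ^ 2 + e ^ 2) / (((k₀ ^ 2 + e ^ 2 : ℝ)) : ℂ) * (I * k₀ + e)) *
        (f' ((k₀ + q₀) ^ 2 + (e + δ e) ^ 2) / ((((k₀ + q₀) ^ 2 + (e + δ e) ^ 2 : ℝ)) : ℂ) *
            (I * ((k₀ + q₀ : ℝ) : ℂ) + ((e + δ e : ℝ) : ℂ)) -
          f' (k₀ ^ 2 + e ^ 2) / (((k₀ ^ 2 + e ^ 2 : ℝ)) : ℂ) * (I * k₀ + e)) = 0 := by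
  rcases le_or_gt (R₁ ^ 2) (k₀ ^ 2 + e ^ 2) with hs | hs
  · rw [hout _ hs]; simp
  · have hrad : Real.sqrt (k₀ ^ 2 + e ^ 2) < R₁ := by
      rw [show R₁ = Real.sqrt (R₁ ^ 2) by rw [Real.sqrt_sq hR₁]]
      exact Real.sqrt_lt_sqrt (by positivity) hs
    have hR₂ : 0 ≤ R₂ := hR₁.trans ((le_add_of_nonneg_right (by positivity)).trans hgap)
    have h1 : k₀ ^ 2 + e ^ 2 ≤ R₂ ^ 2 := by nlinarith [abs_nonneg q₀, abs_nonneg (δ e)]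
    have h2 : (k₀ + q₀) ^ 2 + (e + δ e) ^ 2 ≤ R₂ ^ 2 := by
      have hle := kllb_sqrt_shift_le k₀ e q₀ (δ e)
      have hR₂ge : Real.sqrt ((k₀ + q₀) ^ 2 + (e + δ e) ^ 2) ≤ R₂ := by linarith
      calc (k₀ + q₀) ^ 2 + (e + δ e) ^ 2 = Real.sqrt ((k₀ + q₀) ^ 2 + (e + δ e) ^ 2) ^ 2 := (Real.sq_sqrt (by positivity)).symm
        _ ≤ R₂ ^ 2 := by gcongr
    rw [hin' _ h1, hin' _ h2]; simp

end Gap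

/-! ## §3 The (T)-ladder arithmetic `Σ_{m ≤ n'} Λ_m⁻¹ ≤ (4/3)·Λ_{n'}⁻¹` -/

section Ladder

/-- `Σ_{m ≤ n'} Λ_m⁻¹ ≤ (4/3)·Λ_{n'}⁻¹`. -/
theorem kllb_sum_inv_klScale_le (n' : ℕ) :
    ∑ m ∈ range (n' + 1), (klScale klE0 m)⁻¹ ≤ 4 / 3 * (klScale klE0 n')⁻¹ := by
  have hn := klth_klScale_pos n'
  calc ∑ m ∈ range (n' + 1), (klScale klE0 m)⁻¹
      = ∑ m ∈ range (n' + 1), ((4 : ℝ) ^ (n' - m))⁻¹ * (klScale klE0 n')⁻¹ := by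
        refine sum_congr rfl fun m hm => ?_
        exact kllb_inv_klScale_eq (Nat.lt_succ_iff.mp (mem_range.mp hm))
    _ = (∑ m ∈ range (n' + 1), ((4 : ℝ) ^ (n' - m))⁻¹) * (klScale klE0 n')⁻¹ := by rw [sum_mul]
    _ ≤ 4 / 3 * (klScale klE0 n')⁻¹ :=
        mul_le_mul_of_nonneg_right (sum_inv_four_pow_reflect_le le_rfl) (by positivity)

/-- **The ladder law, abstract**: per-slice bounds `T m ≤ C/Λ_m` (`m ≤ n'`, `C ≥ 0`) sum to `Σ_{m ≤ n'} T m ≤ (4/3)·C/Λ_{n'}`. -/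
theorem kllb_ladder_sum_le {T : ℕ → ℝ} {C : ℝ} (hC : 0 ≤ C) {n' : ℕ} (hT : ∀ m ≤ n', T m ≤ C / klScale klE0 m) :
    ∑ m ∈ range (n' + 1), T m ≤ 4 / 3 * C / klScale klE0 n' := by
  calc ∑ m ∈ range (n' + 1), T m ≤ ∑ m ∈ range (n' + 1), C * (klScale klE0 m)⁻¹ := by
        refine sum_le_sum fun m hm => ?_
        rw [← div_eq_mul_inv]
        exact hT m (Nat.lt_succ_iff.mp (mem_range.mp hm))
    _ = C * ∑ m ∈ range (n' + 1), (klScale klE0 m)⁻¹ := by rw [mul_sum]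
    _ ≤ C * (4 / 3 * (klScale klE0 n')⁻¹) := mul_le_mul_of_nonneg_left (kllb_sum_inv_klScale_le n') hC
    _ = 4 / 3 * C / klScale klE0 n' := by ring

end Ladder

end Summit.HubbardSuperconductivity.HubbardSuperconductivity.Theorems.KLRegimeSplit

end
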